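/-
Copyright (c) 2026 the pub-hodgecm-mathlib formalisation cell (harness21).  Prover seat hodgecm-mathlib-LH4-p10 (g8) (valve hand on strike line L1, LEAD F0P6-plan
(g14) BATCH #154 (1), second hand under LH4-p08 (g11)): Track B «K2-LIT», hLiu418 = stmt-HodgeConjecture-24832; socket #41, KIND W, (iii-arch-hol) — the
archimedean CONTINUATION letter `hex` of ★ `K2LiuKindWArchLetterDefs`, hypothesis-first in the per-place twisted (Whittaker) letters.  THEOREMS ONLY.
-/
import Summits.HodgeConjecture.HodgeConjecture.Theorems.K2LiuArchBlockOfFrameEnd       -- ★ (E8) END (K2Liu-p03 ∕ p11): FILE 10, FILE 11, FILE 12, the frame letters, `unipDeltaArch`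
import Mathlib.MeasureTheory.Integral.Pi                                               -- `integral_fintype_prod_volume_eq_prod`
import HarnessLib

/-!
# Crux `HLiu418`, socket #41, KIND W, (iii-arch-hol): THE TWISTED ARCHIMEDEAN BLOCK `∫_{N_Δ(L⁺⊗ℝ)} W(u)·∏_w F_w(Fr((w_Δ)_∞·u·h) w) dν_∞(u)` IS A HOLOMORPHIC
# FUNCTION OF `s` ON `{0 < re s}` — the KIND-W twin of ★ `K2LiuArchBlockOfFrameEnd`, hypothesis-first in the PER-PLACE TWISTED LETTERS

Cell `hodgecm-mathlib`, crux item hLiu418 = `stmt-HodgeConjecture-24832`; squad K2, strike line L1 (valve hand LH4-p10 (g8) from F0∕P3c∕LH4), KW desk F0P2-p08 (g3),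
(iii-arch) LH4-p08 (g11).  Lane `--supports stmt-HodgeConjecture-24832 --as helper` (count-neutral).  THEOREMS ONLY (no `def`, no instance, no notation, no named-fact
hypothesis, no `sorry`, default heartbeats).

THE POINT.  ★ `K2LiuKindWArchLetterDefs` (LH4-p08, p863152) makes the continued archimedean KIND-W letter `Finf := kindWArchLetter …` a declaration with `hFinf`
UNCONDITIONAL, and `hFinfI` conditional on ONE existence letter per `(j, S, h)` with `det S ≠ 0`:
  `hex : ∃ F, DifferentiableOn ℂ F {0 < re} ∧ ∀ s, n∕2 < re s → F s = archWhittakerIntegral ν S (FinfT j S h) h_∞ s`,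
the continuation to `{0 < re s}` of the TWISTED arch block `∫ conj ψ_S(ι_∞ u) · Φ_s((w_Δ)_∞ · u · g) dν(u)`.  For KIND 0 (no twist) the tree has the whole road:
★ FILE 12 `K2LiuArchUnipotentFrameCoordinates` (frame coordinates `Φ : N_Δ(L⁺⊗ℝ) ≃ₜ ∏_w ℝ^{2×2}`, `Fr u w = n(hermOfReal (Φ u w))`), ★ FILE 11
`K2LiuArchUnipotentHaarTransport.exists_integral_comp_eq_smul` (`∫ dν = c·∫ d(Lebesgue)`), ★ FILE 10 `K2LiuArchBlockOfFrame` (per place the intertwining scalar is holomorphic)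
and ★ END `K2LiuArchBlockOfFrameEnd.exists_continuation_integral_unipDeltaArch{,_of_record}`.  KIND W inserts a unimodular WEIGHT that is a product over the complex places
of functions of the frame coordinate, `W(u) = ∏_w e_w((Fr u w)₁₂)` (the character `conj ψ_S(ι_∞ u) = ∏_w e(−tr(h_w b_w))` read in the frame; BY VALUE here), so the per-place
object becomes the TWISTED integral `∫_{Herm₂} F_w(x_w·n(b)·g_w)·e_w(b) db` — the archimedean WHITTAKER function of the flat section — whose continuation is ★ for
DEFINITE framed indices (★ JUNCTION `K2LiuKFiniteSectionWhittakerHolomorphyGrowth.kFiniteSection_whittaker_holomorphy_growth`) and OPEN for indefinite ones (Shimura 1982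
§3–§4, the organ «Φ6b-ind»).  THIS FILE is the END LEMMA of the twisted road, HYPOTHESIS-FIRST IN THE PER-PLACE TWISTED LETTER (signature-agnostic):
  `hW w : ∃ E_w, DifferentiableOn ℂ E_w {0 < re} ∧ ∀ s, s₁ < re s → ∀ F flat of type (Q_w, k_w), ∫ r, F(x_w·n(hermOfReal r)·g_w)·e_w(hermOfReal r) dr = E_w(s)`,
and NOTHING ELSE is assumed about the weight.
* §1 `exists_continuation_twisted_prod_of_coordinates` — generic `N` with coordinates `Φ` (`Φ(uv) = Φu + Φv`), frame reading `Fr u w = n(hermOfReal (Φ u w))`, any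
  left-invariant `ν` finite on compacts: ONE `E = c·∏_w E_w` holomorphic on `{0 < re}` computes `∫_N (∏_w e_w(hermOfReal(Φ u w)))·∏_w F_w(x_w·Fr u w·g_w) dν = E(s)` on
  `{s₁ < re}` for EVERY flat family (★ FILE 11 + Mathlib `integral_fintype_prod_volume_eq_prod` + ★ (H1) `differentiableOn_finset_prod` — no integrability needed).
* §2 `exists_continuation_twisted_prod_of_frame` — a multiplicative frame `Fr : A → ∏_w M₄(ℂ)` on a group `A ≥ N`, `x₀` with `Fr x₀ w = x_w`: integrand
  `(∏_w e_w((Fr u w)₁₂))·∏_w F_w(Fr(x₀·u·h) w)`.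
* §3 **`exists_continuation_twisted_unipDeltaArch_of_record`** — THE RECORD CURRENCY of ★ `unipDeltaArch`: the adelic frame
  letters `(T, Tinv, Fr, hFr, hT1, hT2, hTU, hTiv, hTN)` of ★ `K2LiuHolTubeRigidityOfFrame` BY VALUE, the anti-diagonal reading `hBC`, ANY Haar `ν_∞`, any `h ∈ H_∞`; the weight
  `Wt : N_Δ(L⁺⊗ℝ) → ℂ` with its frame reading `hWt : Wt u = ∏_w e_w((Fr u w)₁₂)`; the per-place letters `hW` ⊢
  `∃ E, DifferentiableOn ℂ E {0<re} ∧ ∀ s, s₁ < re s → ∀ F flat, ∫ Wt u · ∏_w F_w(Fr((w_Δ)_∞·u·h) w) dν_∞(u) = E s`.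
* §4 **`exists_continuation_twisted_of_presentation`** — the `hex` SHAPE: for an arch family `Φfam : ℂ → H_∞ → ℂ` PRESENTED on `{s₁ < re}` as a flat product over the
  complex places, `Φfam s a = ∏_w F_{s,w}(Fr a w)`, `∃ E, DifferentiableOn ℂ E {0<re} ∧ ∀ s, s₁ < re s → ∫ Wt u · Φfam s ((w_Δ)_∞·u·h) dν_∞ = E s` — with
  `Wt u := conj ψ_S(ι_∞ u)` and `s₁ ≤ n∕2` this IS ★ `K2LiuKindWArchLetterDefs`' `hex` at `(j, S, h)`.
* §4′ the two of-record heads with PLACE-DEPENDENT abscissae inside each letter (`∃ Ew s₀`, ★ JUNCTION's literal shape; conclusion `∃ E s₁`).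
* §5 integrability of the twisted integrand on `{½ < re}` from ★ END `integrable_prod_unipDeltaArch_of_record` (`‖Wt‖ ≤ 1`, Mathlib `Integrable.bdd_mul`).
What this file does NOT do (honest): the per-place twisted letters `hW` (DEFINITE framed index: ★ JUNCTION after the Levi∕chart∕translate bookkeeping — FILE B; INDEFINITE:
the organ «Φ6b-ind», OPEN), the frame reading of the character `conj ψ_S(ι_∞ u) = ∏_w e_w((Fr u w)₁₂)`, and the flat product presentation of (KW-fac)'s `FinfT j S h`.
HONEST LABEL.  Count-neutral helper; it moves the KIND-W arch residue `hex` onto the per-place twisted letters and nothing more: `HC_CM` is proved only modulo the 7 printed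
citations (2 remaining named inputs: hLiu418 = `stmt-HodgeConjecture-24832`, h413 = `stmt-HodgeConjecture-24833`) until rung 0 closes.

## References
* [Shimura1982] G. Shimura, *Confluent hypergeometric functions on tube domains*, Math. Ann. 260 (1982), §3 Thm. 3.1, §4 Thm. 4.2 (the arch Whittaker functions `ξ(g,h;α,β)`).
* [Shimura1997] G. Shimura, *Euler Products and Eisenstein Series*, CBMS 93 (1997), §16.4, §18.4 (Fourier coefficients of Siegel Eisenstein series, archimedean factors).
* [KudlaRallis1994] S. Kudla, S. Rallis, Ann. of Math. 140 (1994), §1–§2 (Euler factorisation of the Fourier coefficients).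
* [BorelJacquet1979] A. Borel, H. Jacquet, Proc. Symp. Pure Math. 33 (1979), §4.1 (archimedean components).
* [Folland1995] G. Folland, *A Course in Abstract Harmonic Analysis* (1995), §2.2 (uniqueness of Haar measure, Fubini).
-/

set_option autoImplicit false
set_option linter.dupNamespace false -- the mandated namespace repeats `HodgeConjecture.HodgeConjecture`

noncomputable section

open Complex Matrix MeasureTheory MeasureTheory.Measure NumberField
open scoped ComplexConjugate NNReal
open Literature.NumberTheory.Automorphic Literature.NumberTheory.GelbartRogawski1991 Literature.NumberTheory.GelbartRogawski1991.GRConstruction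
open Literature.NumberTheory.K2Lit.SiegelDoubled
open Summit.HodgeConjecture.HodgeConjecture.Cruxes.HLiu418.K2LiuArchInducedTubeDefs
open Summit.HodgeConjecture.HodgeConjecture.Cruxes.HLiu418.K2LiuU22CompactPictureDefs
open Summit.HodgeConjecture.HodgeConjecture.Cruxes.HLiu418.K2LiuArchUnipotentHaarTransport (exists_integral_comp_eq_smul)
open Summit.HodgeConjecture.HodgeConjecture.Cruxes.HLiu418.K2LiuSiegelUnipotentLocalDefs (unipDeltaArch)
open Summit.HodgeConjecture.HodgeConjecture.Cruxes.HLiu418.K2LiuHolTubeRigidityOfFrame (frame_mul frame_mem frame_archPart_weylDelta)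
open Summit.HodgeConjecture.HodgeConjecture.Cruxes.HLiu418.K2LiuLadderIntertwinerScalars (differentiableOn_finset_prod)
open Summit.HodgeConjecture.HodgeConjecture.Cruxes.HLiu418.K2LiuArchBlockOfFrameEnd (integrable_prod_unipDeltaArch_of_record)

namespace Summit.HodgeConjecture.HodgeConjecture.Cruxes.HLiu418.K2LiuKindWArchContinuation

/-! ## §1 Generic coordinates: the twisted block through ★ FILE 11 and the per-place twisted letters -/

/-- **TWISTED END LEMMA, generic coordinates.**  `σ` finite; `x_w, g_w ∈ M₄(ℂ)`; weights `k_w`, compact pictures `Q_w`; a group `N` with coordinates `Φ : N ≃ₜ ∏_w ℝ^{2×2}`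
turning products into sums and a frame reading `Fr u w = n(hermOfReal (Φ u w))`; `ν` left-invariant and finite on compacts; a weight that is a product over the places of
functions `e_w` of the Hermitian coordinate; and PER PLACE a twisted continuation letter BY VALUE on `{s₁ < re}`.  Then ONE `E`, holomorphic on `{0 < re s}`, computes
`∫_N (∏_w e_w(hermOfReal(Φ u w))) · ∏_w F_w(x_w · Fr u w · g_w) dν(u) = E(s)` (`s₁ < re s`) for EVERY flat family `F_w ∈ I_w(s, χ_{k_w})`, `cp F_w = Q_w` — no integrability
hypothesis (★ FILE 11 holds for every integrand, Mathlib `integral_fintype_prod_volume_eq_prod` is unconditional). [cite: Shimura1997, §16.4] [cite: KudlaRallis1994, §1–§2]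
[cite: Folland1995, §2.2] -/
theorem exists_continuation_twisted_prod_of_coordinates {σ : Type*} [Fintype σ] (k : σ → ℤ) (Q : σ → Carrier)
    (x g : σ → Matrix (Fin 2 ⊕ Fin 2) (Fin 2 ⊕ Fin 2) ℂ)
    {N : Type*} [Group N] [TopologicalSpace N] [ContinuousMul N] [MeasurableSpace N] [BorelSpace N]
    (Φ : N ≃ₜ (σ → (Fin 2 → Fin 2 → ℝ))) (hΦ : ∀ u v : N, Φ (u * v) = Φ u + Φ v)
    (Fr : N → σ → Matrix (Fin 2 ⊕ Fin 2) (Fin 2 ⊕ Fin 2) ℂ) (hFr : ∀ u w, Fr u w = fromBlocks 1 (hermOfReal (Φ u w)) 0 1)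
    (ν : Measure N) [IsFiniteMeasureOnCompacts ν] [ν.IsMulLeftInvariant]
    (eb : σ → Matrix (Fin 2) (Fin 2) ℂ → ℂ) (s₁ : ℝ)
    (hW : ∀ w, ∃ Ew : ℂ → ℂ, DifferentiableOn ℂ Ew {s : ℂ | 0 < s.re} ∧ ∀ s : ℂ, s₁ < s.re →
      ∀ F : Matrix (Fin 2 ⊕ Fin 2) (Fin 2 ⊕ Fin 2) ℂ → ℂ, IsArchSiegelSection (fun z : ℂ => (conj z / ((‖z‖ : ℝ) : ℂ)) ^ (k w)) s F →
        (∀ (v : Matrix (Fin 2) (Fin 2) ℂ), vᴴ * v = 1 → ∀ hv : v.det ≠ 0,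
          F ((2 : ℂ)⁻¹ • fromBlocks (1 + v) (-(I • (1 - v))) (I • (1 - v)) (1 + v) : Matrix (Fin 2 ⊕ Fin 2) (Fin 2 ⊕ Fin 2) ℂ) = evalAt v hv (Q w)) →
        ∫ r : Fin 2 → Fin 2 → ℝ, F (x w * fromBlocks 1 (hermOfReal r) 0 1 * g w) * eb w (hermOfReal r) = Ew s) :
    ∃ E : ℂ → ℂ, DifferentiableOn ℂ E {s : ℂ | 0 < s.re} ∧ ∀ s : ℂ, s₁ < s.re →
      ∀ F : σ → Matrix (Fin 2 ⊕ Fin 2) (Fin 2 ⊕ Fin 2) ℂ → ℂ, (∀ w, IsArchSiegelSection (fun z : ℂ => (conj z / ((‖z‖ : ℝ) : ℂ)) ^ (k w)) s (F w)) →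
        (∀ w, ∀ (v : Matrix (Fin 2) (Fin 2) ℂ), vᴴ * v = 1 → ∀ hv : v.det ≠ 0,
          (F w) ((2 : ℂ)⁻¹ • fromBlocks (1 + v) (-(I • (1 - v))) (I • (1 - v)) (1 + v) : Matrix (Fin 2 ⊕ Fin 2) (Fin 2 ⊕ Fin 2) ℂ) = evalAt v hv (Q w)) →
        ∫ u, (∏ w, eb w (hermOfReal (Φ u w))) * ∏ w, F w (x w * Fr u w * g w) ∂ν = E s := by
  -- Lebesgue on `∏_w Herm₂ ≅ (σ → (Fin 2 → Fin 2 → ℝ))` is an additive Haar measure (nested `pi`; `volume_pi` is `rfl`)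
  haveI h22 : (volume : Measure (Fin 2 → Fin 2 → ℝ)).IsAddHaarMeasure := Measure.pi.isAddHaarMeasure _
  haveI : (volume : Measure (σ → (Fin 2 → Fin 2 → ℝ))).IsAddHaarMeasure := Measure.pi.isAddHaarMeasure _
  -- ★ FILE 11: `∫ G (Φ u) dν = c • ∫ G d(Lebesgue)` for EVERY `G`
  obtain ⟨c, hc⟩ := exists_integral_comp_eq_smul (volume : Measure (σ → (Fin 2 → Fin 2 → ℝ))) Φ hΦ ν (F := ℂ)
  -- the per-place twisted letters, chosen once
  choose Ew hEw hEwq using hW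
  refine ⟨fun s => ((c : ℝ) : ℂ) * ∏ w, Ew w s, (differentiableOn_const _).mul (differentiableOn_finset_prod _ _ _ fun w _ => hEw w), fun s hs F hF hQ => ?_⟩
  have hG := hc (fun r : σ → (Fin 2 → Fin 2 → ℝ) =>
    (∏ w, eb w (hermOfReal (r w))) * ∏ w, F w (x w * fromBlocks 1 (hermOfReal (r w)) 0 1 * g w))
  have hint : ∫ u, (∏ w, eb w (hermOfReal (Φ u w))) * ∏ w, F w (x w * Fr u w * g w) ∂ν =
      ∫ u, (fun r : σ → (Fin 2 → Fin 2 → ℝ) => (∏ w, eb w (hermOfReal (r w))) * ∏ w, F w (x w * fromBlocks 1 (hermOfReal (r w)) 0 1 * g w)) (Φ u) ∂ν :=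
    integral_congr_ae (Filter.Eventually.of_forall fun u => by simp only [hFr])
  -- the integrand on `∏_w Herm₂` is a product over the places of one-place twisted integrands
  have hprod : (fun r : σ → (Fin 2 → Fin 2 → ℝ) => (∏ w, eb w (hermOfReal (r w))) * ∏ w, F w (x w * fromBlocks 1 (hermOfReal (r w)) 0 1 * g w)) =
      fun r => ∏ w, (F w (x w * fromBlocks 1 (hermOfReal (r w)) 0 1 * g w) * eb w (hermOfReal (r w))) := by
    funext r
    rw [mul_comm, ← Finset.prod_mul_distrib]
  rw [hint, hG, hprod, integral_fintype_prod_volume_eq_prod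
    (fun w (r : Fin 2 → Fin 2 → ℝ) => F w (x w * fromBlocks 1 (hermOfReal r) 0 1 * g w) * eb w (hermOfReal r)),
    Finset.prod_congr rfl fun w _ => hEwq w s hs (F w) (hF w) (hQ w), NNReal.smul_def, Complex.real_smul]

/-! ## §2 A multiplicative frame on a bigger group: the integrand `(∏_w e_w((Fr u w)₁₂)) · ∏_w F_w(Fr(x₀ · u · h) w)` -/

/-- **TWISTED END LEMMA through a multiplicative frame.**  `A` a group with a multiplicative frame `Fr : A → ∏_w M₄(ℂ)`; `N ≤ A` with coordinates `Φ` (`Φ(uv) = Φu + Φv`,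
`Fr u w = n(hermOfReal (Φ u w))` on `N`); `x₀ ∈ A` with `Fr x₀ w = x_w`; `h ∈ A`; the weight read off the `(1,2)`-block of the frame, `∏_w e_w((Fr u w)₁₂)`; per place the
twisted letter at `(x_w, g_w := Fr h w)`.  Then ONE holomorphic `E` on `{0 < re s}` computes `∫_N (∏_w e_w((Fr u w)₁₂)) · ∏_w F_w(Fr(x₀ · u · h) w) dν(u) = E(s)`
(`s₁ < re s`) for every flat family (§1). [cite: Shimura1997, §16.4] [cite: KudlaRallis1994, §1–§2] -/
theorem exists_continuation_twisted_prod_of_frame {σ : Type*} [Fintype σ] (k : σ → ℤ) (Q : σ → Carrier)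
    {A : Type*} [Group A] [TopologicalSpace A] [IsTopologicalGroup A]
    (Fr : A → σ → Matrix (Fin 2 ⊕ Fin 2) (Fin 2 ⊕ Fin 2) ℂ) (hmul : ∀ a b w, Fr (a * b) w = Fr a w * Fr b w)
    (N : Subgroup A) [MeasurableSpace N] [BorelSpace N]
    (Φ : N ≃ₜ (σ → (Fin 2 → Fin 2 → ℝ))) (hΦ : ∀ u v : N, Φ (u * v) = Φ u + Φ v)
    (hFr : ∀ (u : N) w, Fr (u : A) w = fromBlocks 1 (hermOfReal (Φ u w)) 0 1)
    (ν : Measure N) [IsFiniteMeasureOnCompacts ν] [ν.IsMulLeftInvariant]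
    (x : σ → Matrix (Fin 2 ⊕ Fin 2) (Fin 2 ⊕ Fin 2) ℂ) (x₀ : A) (hx₀ : ∀ w, Fr x₀ w = x w) (h : A)
    (eb : σ → Matrix (Fin 2) (Fin 2) ℂ → ℂ) (s₁ : ℝ)
    (hW : ∀ w, ∃ Ew : ℂ → ℂ, DifferentiableOn ℂ Ew {s : ℂ | 0 < s.re} ∧ ∀ s : ℂ, s₁ < s.re →
      ∀ F : Matrix (Fin 2 ⊕ Fin 2) (Fin 2 ⊕ Fin 2) ℂ → ℂ, IsArchSiegelSection (fun z : ℂ => (conj z / ((‖z‖ : ℝ) : ℂ)) ^ (k w)) s F →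
        (∀ (v : Matrix (Fin 2) (Fin 2) ℂ), vᴴ * v = 1 → ∀ hv : v.det ≠ 0,
          F ((2 : ℂ)⁻¹ • fromBlocks (1 + v) (-(I • (1 - v))) (I • (1 - v)) (1 + v) : Matrix (Fin 2 ⊕ Fin 2) (Fin 2 ⊕ Fin 2) ℂ) = evalAt v hv (Q w)) →
        ∫ r : Fin 2 → Fin 2 → ℝ, F (x w * fromBlocks 1 (hermOfReal r) 0 1 * Fr h w) * eb w (hermOfReal r) = Ew s) :
    ∃ E : ℂ → ℂ, DifferentiableOn ℂ E {s : ℂ | 0 < s.re} ∧ ∀ s : ℂ, s₁ < s.re →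
      ∀ F : σ → Matrix (Fin 2 ⊕ Fin 2) (Fin 2 ⊕ Fin 2) ℂ → ℂ, (∀ w, IsArchSiegelSection (fun z : ℂ => (conj z / ((‖z‖ : ℝ) : ℂ)) ^ (k w)) s (F w)) →
        (∀ w, ∀ (v : Matrix (Fin 2) (Fin 2) ℂ), vᴴ * v = 1 → ∀ hv : v.det ≠ 0,
          (F w) ((2 : ℂ)⁻¹ • fromBlocks (1 + v) (-(I • (1 - v))) (I • (1 - v)) (1 + v) : Matrix (Fin 2 ⊕ Fin 2) (Fin 2 ⊕ Fin 2) ℂ) = evalAt v hv (Q w)) →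
        ∫ u : N, (∏ w, eb w (Matrix.toBlocks₁₂ (Fr (u : A) w))) * ∏ w, F w (Fr (x₀ * (u : A) * h) w) ∂ν = E s := by
  obtain ⟨E, hE, hEq⟩ := exists_continuation_twisted_prod_of_coordinates k Q x (fun w => Fr h w) Φ hΦ (fun (u : N) w => Fr (u : A) w) hFr ν eb s₁ hW
  refine ⟨E, hE, fun s hs F hF hQ => ?_⟩
  have hint : ∫ u : N, (∏ w, eb w (Matrix.toBlocks₁₂ (Fr (u : A) w))) * ∏ w, F w (Fr (x₀ * (u : A) * h) w) ∂ν =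
      ∫ u : N, (∏ w, eb w (hermOfReal (Φ u w))) * ∏ w, F w (x w * Fr (u : A) w * Fr h w) ∂ν :=
    integral_congr_ae (Filter.Eventually.of_forall fun u => by simp only [hmul, hx₀, hFr, Matrix.toBlocks_fromBlocks₁₂])
  rw [hint]
  have hEq' := hEq s hs F hF hQ
  simp only [hFr] at hEq' ⊢
  exact hEq'

/-! ## §3 The record currency: `N_Δ(L⁺ ⊗ ℝ) ≤ H_∞`, the adelic frame, `x₀ = (w_Δ)_∞` -/

variable (L : Type) [Field L] [NumberField L] [IsCMField L]
variable {N₀ M₀ : ℕ} (e : Fin N₀ × Fin M₀ ≃ Fin 2)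
  (dV : Fin N₀ → L) (hdV : ∀ i, IsCMField.complexConj L (dV i) = dV i)
  (dW : Fin M₀ → L) (hdW : ∀ i, IsCMField.complexConj L (dW i) = dW i)
  (T Tinv : {w : InfinitePlace L // w.IsComplex} → Matrix (Fin 2 ⊕ Fin 2) (Fin 2 ⊕ Fin 2) ℂ)
  (Fr : UnitaryGroup.arch (Fp L) L (IsCMField.complexConj L) (2 + 2) (hermD L e dV hdV dW hdW) →
    {w : InfinitePlace L // w.IsComplex} → Matrix (Fin 2 ⊕ Fin 2) (Fin 2 ⊕ Fin 2) ℂ)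
  (hFr : ∀ a w, Fr a w = T w * Matrix.reindex (e₂ (n := 2)).symm (e₂ (n := 2)).symm
    (((UnitaryGroup.archAt (Fp L) L (IsCMField.complexConj L) (2 + 2) (hermD L e dV hdV dW hdW) w
      (UnitaryGroup.complexConj_smul_infinitePlace L w.1) (IsCMField.complexConj_ne_one L) a :
        UnitaryGroup.archLocal L (2 + 2) (hermD L e dV hdV dW hdW) w) : GL (Fin (2 + 2)) ℂ) : Matrix (Fin (2 + 2)) (Fin (2 + 2)) ℂ) * Tinv w)
  (hT2 : ∀ w, Tinv w * T w = 1)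
  (hTU : ∀ w (g : GL (Fin (2 + 2)) ℂ), g ∈ UnitaryGroup.archLocal L (2 + 2) (hermD L e dV hdV dW hdW) w →
    (T w * Matrix.reindex (e₂ (n := 2)).symm (e₂ (n := 2)).symm (g : Matrix _ _ ℂ) * Tinv w)ᴴ * Matrix.J (Fin 2) ℂ *
      (T w * Matrix.reindex (e₂ (n := 2)).symm (e₂ (n := 2)).symm (g : Matrix _ _ ℂ) * Tinv w) = Matrix.J (Fin 2) ℂ)
  [MeasurableSpace ↥(unipDeltaArch L e dV hdV dW hdW)] [BorelSpace ↥(unipDeltaArch L e dV hdV dW hdW)]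
  [Fintype {w : InfinitePlace L // w.IsComplex}]

include hFr hT2 in
/-- **TWISTED END LEMMA OF RECORD — no coordinate binder.**  Under the frame letters of record `(T, Tinv, Fr, hFr, hT1, hT2, hTiv, hTN)` (★ `K2LiuHolTubeRigidityOfFrame` §2 ∕
★ `exists_tubeFrame_arch₃`), the anti-diagonal reading `hBC`, ANY Haar `ν_∞` on `N_Δ(L⁺ ⊗ ℝ)`, any `h ∈ H_∞`, weights `k_w`, compact pictures `Q_w`, a weight `Wt` read in the
frame and the per-place twisted letters on `{s₁ < re}`: ONE `E` holomorphic on `{0 < re s}` with `s₁ < re s → ∫ Wt u · ∏_w F_w(Fr((w_Δ)_∞ · u · h) w) dν_∞(u) = E(s)` for every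
flat family (§3 at the coordinates of ★ `K2LiuArchUnipotentFrameCoordinates.exists_frameCoordinates`). [cite: Shimura1997, §16.4] [cite: KudlaRallis1994, §1–§2]
[cite: BorelJacquet1979, §4.1] [cite: Folland1995, §2.2] -/
theorem exists_continuation_twisted_unipDeltaArch_of_record (hT1 : ∀ w, T w * Tinv w = 1)
    (hTiv : ∀ w (u : GL (Fin (2 + 2)) ℂ), u ∈ UnitaryGroup.archLocal L (2 + 2) (hermD L e dV hdV dW hdW) w →
      K2LiuSiegelUnipotentLocalDefs.IsUnipM (n := 2) (u : Matrix (Fin (2 + 2)) (Fin (2 + 2)) ℂ) →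
        ∃ b : Matrix (Fin 2) (Fin 2) ℂ, bᴴ = b ∧ T w * Matrix.reindex (e₂ (n := 2)).symm (e₂ (n := 2)).symm (u : Matrix _ _ ℂ) * Tinv w = fromBlocks 1 b 0 1)
    (hTN : ∀ w (b : Matrix (Fin 2) (Fin 2) ℂ), bᴴ = b → ∃ u : GL (Fin (2 + 2)) ℂ,
      u ∈ UnitaryGroup.archLocal L (2 + 2) (hermD L e dV hdV dW hdW) w ∧ K2LiuSiegelUnipotentLocalDefs.IsUnipM (n := 2) (u : Matrix (Fin (2 + 2)) (Fin (2 + 2)) ℂ) ∧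
        T w * Matrix.reindex (e₂ (n := 2)).symm (e₂ (n := 2)).symm (u : Matrix _ _ ℂ) * Tinv w = fromBlocks 1 b 0 1)
    (νinf : Measure ↥(unipDeltaArch L e dV hdV dW hdW)) [νinf.IsHaarMeasure]
    (B C : {w : InfinitePlace L // w.IsComplex} → Matrix (Fin 2) (Fin 2) ℂ) (hBC : ∀ w, T w * fromBlocks 1 0 0 (-1) * Tinv w = fromBlocks 0 (B w) (C w) 0)
    (k : {w : InfinitePlace L // w.IsComplex} → ℤ) (Q : {w : InfinitePlace L // w.IsComplex} → Carrier)
    (h : UnitaryGroup.arch (Fp L) L (IsCMField.complexConj L) (2 + 2) (hermD L e dV hdV dW hdW))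
    (eb : {w : InfinitePlace L // w.IsComplex} → Matrix (Fin 2) (Fin 2) ℂ → ℂ)
    (Wt : ↥(unipDeltaArch L e dV hdV dW hdW) → ℂ)
    (hWt : ∀ u : ↥(unipDeltaArch L e dV hdV dW hdW),
      Wt u = ∏ w, eb w (Matrix.toBlocks₁₂ (Fr (u : UnitaryGroup.arch (Fp L) L (IsCMField.complexConj L) (2 + 2) (hermD L e dV hdV dW hdW)) w)))
    (s₁ : ℝ)
    (hW : ∀ w, ∃ Ew : ℂ → ℂ, DifferentiableOn ℂ Ew {s : ℂ | 0 < s.re} ∧ ∀ s : ℂ, s₁ < s.re →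
      ∀ F : Matrix (Fin 2 ⊕ Fin 2) (Fin 2 ⊕ Fin 2) ℂ → ℂ, IsArchSiegelSection (fun z : ℂ => (conj z / ((‖z‖ : ℝ) : ℂ)) ^ (k w)) s F →
        (∀ (v : Matrix (Fin 2) (Fin 2) ℂ), vᴴ * v = 1 → ∀ hv : v.det ≠ 0,
          F ((2 : ℂ)⁻¹ • fromBlocks (1 + v) (-(I • (1 - v))) (I • (1 - v)) (1 + v) : Matrix (Fin 2 ⊕ Fin 2) (Fin 2 ⊕ Fin 2) ℂ) = evalAt v hv (Q w)) →
        ∫ r : Fin 2 → Fin 2 → ℝ, F ((fromBlocks 0 (B w) (C w) 0 : Matrix (Fin 2 ⊕ Fin 2) (Fin 2 ⊕ Fin 2) ℂ) * fromBlocks 1 (hermOfReal r) 0 1 * Fr h w) *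
          eb w (hermOfReal r) = Ew s) :
    ∃ E : ℂ → ℂ, DifferentiableOn ℂ E {s : ℂ | 0 < s.re} ∧ ∀ s : ℂ, s₁ < s.re →
      ∀ F : {w : InfinitePlace L // w.IsComplex} → Matrix (Fin 2 ⊕ Fin 2) (Fin 2 ⊕ Fin 2) ℂ → ℂ,
        (∀ w, IsArchSiegelSection (fun z : ℂ => (conj z / ((‖z‖ : ℝ) : ℂ)) ^ (k w)) s (F w)) →
        (∀ w, ∀ (v : Matrix (Fin 2) (Fin 2) ℂ), vᴴ * v = 1 → ∀ hv : v.det ≠ 0,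
          (F w) ((2 : ℂ)⁻¹ • fromBlocks (1 + v) (-(I • (1 - v))) (I • (1 - v)) (1 + v) : Matrix (Fin 2 ⊕ Fin 2) (Fin 2 ⊕ Fin 2) ℂ) = evalAt v hv (Q w)) →
        ∫ u : ↥(unipDeltaArch L e dV hdV dW hdW), Wt u * ∏ w, F w (Fr
            (UnitaryGroup.archPart (Fp L) L (IsCMField.complexConj L) (2 + 2) (hermD L e dV hdV dW hdW) (weylDelta L e dV hdV dW hdW) *
              (u : UnitaryGroup.arch (Fp L) L (IsCMField.complexConj L) (2 + 2) (hermD L e dV hdV dW hdW)) * h) w) ∂νinf = E s := by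
  -- the (E8) record head's coordinates, then §2 on `N_Δ(L⁺⊗ℝ) ≤ H_∞` with the adelic frame and `x₀ := (w_Δ)_∞`
  obtain ⟨Φ, hΦ, hΦFr⟩ := K2LiuArchUnipotentFrameCoordinates.exists_frameCoordinates L e dV hdV dW hdW T Tinv Fr hFr hT1 hT2 hTiv hTN
  have hx₀ : ∀ w, Fr (UnitaryGroup.archPart (Fp L) L (IsCMField.complexConj L) (2 + 2) (hermD L e dV hdV dW hdW) (weylDelta L e dV hdV dW hdW)) w =
      fromBlocks 0 (B w) (C w) 0 := fun w => by
    rw [frame_archPart_weylDelta L e dV hdV dW hdW T Tinv Fr hFr w, hBC w]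
  obtain ⟨E, hE, hEq⟩ := exists_continuation_twisted_prod_of_frame k Q Fr (fun a b w => frame_mul L e dV hdV dW hdW T Tinv Fr hFr hT2 a b w)
    (unipDeltaArch L e dV hdV dW hdW) Φ hΦ hΦFr νinf (fun w => (fromBlocks 0 (B w) (C w) 0 : Matrix (Fin 2 ⊕ Fin 2) (Fin 2 ⊕ Fin 2) ℂ)) _ hx₀ h eb s₁ hW
  refine ⟨E, hE, fun s hs F hF hQ => ?_⟩
  have hint : ∫ u : ↥(unipDeltaArch L e dV hdV dW hdW), Wt u * ∏ w, F w (Fr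
        (UnitaryGroup.archPart (Fp L) L (IsCMField.complexConj L) (2 + 2) (hermD L e dV hdV dW hdW) (weylDelta L e dV hdV dW hdW) *
          (u : UnitaryGroup.arch (Fp L) L (IsCMField.complexConj L) (2 + 2) (hermD L e dV hdV dW hdW)) * h) w) ∂νinf =
      ∫ u : ↥(unipDeltaArch L e dV hdV dW hdW), (∏ w, eb w (Matrix.toBlocks₁₂ (Fr (u : UnitaryGroup.arch (Fp L) L (IsCMField.complexConj L) (2 + 2) (hermD L e dV hdV dW hdW)) w))) *
        ∏ w, F w (Fr (UnitaryGroup.archPart (Fp L) L (IsCMField.complexConj L) (2 + 2) (hermD L e dV hdV dW hdW) (weylDelta L e dV hdV dW hdW) *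
          (u : UnitaryGroup.arch (Fp L) L (IsCMField.complexConj L) (2 + 2) (hermD L e dV hdV dW hdW)) * h) w) ∂νinf :=
    integral_congr_ae (Filter.Eventually.of_forall fun u => by simp only [hWt])
  rw [hint]
  exact hEq s hs F hF hQ

/-! ## §4 The `hex` shape: an arch family presented as a flat product over the complex places -/

include hFr hT2 in
/-- **THE KIND-W ARCHIMEDEAN EXISTENCE LETTER FROM A FLAT PRODUCT PRESENTATION.**  Same letters as §3-of-record; and an arch family `Φfam : ℂ → H_∞ → ℂ` PRESENTED on `{s₁ < re}`
as a flat product over the complex places, `Φfam s a = ∏_w F_{s,w}(Fr a w)` with `F_{s,w} ∈ I_w(s, χ_{k_w})`, `cp F_{s,w} = Q_w` (the shape ★ `K2LiuArchFlatTubePresentation` gives the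
standard section's arch part).  Then `∃ E, DifferentiableOn ℂ E {0 < re} ∧ ∀ s, s₁ < re s → ∫ Wt u · Φfam s ((w_Δ)_∞ · u · h) dν_∞(u) = E s` — with `Wt u := conj ψ_S(ι_∞ u)`
(read in the frame by `hWt`) and `s₁ ≤ n∕2` this is ★ `K2LiuKindWArchLetterDefs`' `hex` at `(j, S, h)` (`archWhittakerIntegral ν S Φfam h_∞`). [cite: Shimura1997, §16.4, §18.4]
[cite: KudlaRallis1994, §1–§2] [cite: BorelJacquet1979, §4.1] -/
theorem exists_continuation_twisted_of_presentation (hT1 : ∀ w, T w * Tinv w = 1)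
    (hTiv : ∀ w (u : GL (Fin (2 + 2)) ℂ), u ∈ UnitaryGroup.archLocal L (2 + 2) (hermD L e dV hdV dW hdW) w →
      K2LiuSiegelUnipotentLocalDefs.IsUnipM (n := 2) (u : Matrix (Fin (2 + 2)) (Fin (2 + 2)) ℂ) →
        ∃ b : Matrix (Fin 2) (Fin 2) ℂ, bᴴ = b ∧ T w * Matrix.reindex (e₂ (n := 2)).symm (e₂ (n := 2)).symm (u : Matrix _ _ ℂ) * Tinv w = fromBlocks 1 b 0 1)
    (hTN : ∀ w (b : Matrix (Fin 2) (Fin 2) ℂ), bᴴ = b → ∃ u : GL (Fin (2 + 2)) ℂ,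
      u ∈ UnitaryGroup.archLocal L (2 + 2) (hermD L e dV hdV dW hdW) w ∧ K2LiuSiegelUnipotentLocalDefs.IsUnipM (n := 2) (u : Matrix (Fin (2 + 2)) (Fin (2 + 2)) ℂ) ∧
        T w * Matrix.reindex (e₂ (n := 2)).symm (e₂ (n := 2)).symm (u : Matrix _ _ ℂ) * Tinv w = fromBlocks 1 b 0 1)
    (νinf : Measure ↥(unipDeltaArch L e dV hdV dW hdW)) [νinf.IsHaarMeasure]
    (B C : {w : InfinitePlace L // w.IsComplex} → Matrix (Fin 2) (Fin 2) ℂ) (hBC : ∀ w, T w * fromBlocks 1 0 0 (-1) * Tinv w = fromBlocks 0 (B w) (C w) 0)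
    (k : {w : InfinitePlace L // w.IsComplex} → ℤ) (Q : {w : InfinitePlace L // w.IsComplex} → Carrier)
    (h : UnitaryGroup.arch (Fp L) L (IsCMField.complexConj L) (2 + 2) (hermD L e dV hdV dW hdW))
    (eb : {w : InfinitePlace L // w.IsComplex} → Matrix (Fin 2) (Fin 2) ℂ → ℂ)
    (Wt : ↥(unipDeltaArch L e dV hdV dW hdW) → ℂ)
    (hWt : ∀ u : ↥(unipDeltaArch L e dV hdV dW hdW),
      Wt u = ∏ w, eb w (Matrix.toBlocks₁₂ (Fr (u : UnitaryGroup.arch (Fp L) L (IsCMField.complexConj L) (2 + 2) (hermD L e dV hdV dW hdW)) w)))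
    (s₁ : ℝ)
    (hW : ∀ w, ∃ Ew : ℂ → ℂ, DifferentiableOn ℂ Ew {s : ℂ | 0 < s.re} ∧ ∀ s : ℂ, s₁ < s.re →
      ∀ F : Matrix (Fin 2 ⊕ Fin 2) (Fin 2 ⊕ Fin 2) ℂ → ℂ, IsArchSiegelSection (fun z : ℂ => (conj z / ((‖z‖ : ℝ) : ℂ)) ^ (k w)) s F →
        (∀ (v : Matrix (Fin 2) (Fin 2) ℂ), vᴴ * v = 1 → ∀ hv : v.det ≠ 0,
          F ((2 : ℂ)⁻¹ • fromBlocks (1 + v) (-(I • (1 - v))) (I • (1 - v)) (1 + v) : Matrix (Fin 2 ⊕ Fin 2) (Fin 2 ⊕ Fin 2) ℂ) = evalAt v hv (Q w)) →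
        ∫ r : Fin 2 → Fin 2 → ℝ, F ((fromBlocks 0 (B w) (C w) 0 : Matrix (Fin 2 ⊕ Fin 2) (Fin 2 ⊕ Fin 2) ℂ) * fromBlocks 1 (hermOfReal r) 0 1 * Fr h w) *
          eb w (hermOfReal r) = Ew s)
    (Φfam : ℂ → UnitaryGroup.arch (Fp L) L (IsCMField.complexConj L) (2 + 2) (hermD L e dV hdV dW hdW) → ℂ)
    (Fs : ℂ → {w : InfinitePlace L // w.IsComplex} → Matrix (Fin 2 ⊕ Fin 2) (Fin 2 ⊕ Fin 2) ℂ → ℂ)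
    (hFs : ∀ s : ℂ, s₁ < s.re → ∀ w, IsArchSiegelSection (fun z : ℂ => (conj z / ((‖z‖ : ℝ) : ℂ)) ^ (k w)) s (Fs s w))
    (hFsQ : ∀ s : ℂ, s₁ < s.re → ∀ w, ∀ (v : Matrix (Fin 2) (Fin 2) ℂ), vᴴ * v = 1 → ∀ hv : v.det ≠ 0,
      (Fs s w) ((2 : ℂ)⁻¹ • fromBlocks (1 + v) (-(I • (1 - v))) (I • (1 - v)) (1 + v) : Matrix (Fin 2 ⊕ Fin 2) (Fin 2 ⊕ Fin 2) ℂ) = evalAt v hv (Q w))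
    (hpres : ∀ s : ℂ, s₁ < s.re → ∀ a : UnitaryGroup.arch (Fp L) L (IsCMField.complexConj L) (2 + 2) (hermD L e dV hdV dW hdW), Φfam s a = ∏ w, Fs s w (Fr a w)) :
    ∃ E : ℂ → ℂ, DifferentiableOn ℂ E {s : ℂ | 0 < s.re} ∧ ∀ s : ℂ, s₁ < s.re →
      ∫ u : ↥(unipDeltaArch L e dV hdV dW hdW), Wt u * Φfam s
          (UnitaryGroup.archPart (Fp L) L (IsCMField.complexConj L) (2 + 2) (hermD L e dV hdV dW hdW) (weylDelta L e dV hdV dW hdW) *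
            (u : UnitaryGroup.arch (Fp L) L (IsCMField.complexConj L) (2 + 2) (hermD L e dV hdV dW hdW)) * h) ∂νinf = E s := by
  obtain ⟨E, hE, hEq⟩ := exists_continuation_twisted_unipDeltaArch_of_record L e dV hdV dW hdW T Tinv Fr hFr hT2 hT1 hTiv hTN νinf B C hBC k Q h eb Wt hWt s₁ hW
  refine ⟨E, hE, fun s hs => ?_⟩
  rw [← hEq s hs (Fs s) (hFs s hs) (hFsQ s hs)]
  exact integral_congr_ae (Filter.Eventually.of_forall fun u => by simp only [hpres s hs])

/-! ## §4′ The same two heads with PLACE-DEPENDENT abscissae (★ JUNCTION's literal `∃ F s₀` shape per place) -/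

include hFr hT2 in
/-- **TWISTED END LEMMA OF RECORD, per-place abscissae.**  As `exists_continuation_twisted_unipDeltaArch_of_record`, but each place brings its own abscissa INSIDE the letter —
`hW' w : ∃ Ew s₀, DifferentiableOn ℂ Ew {0 < re} ∧ ∀ s, s₀ < re s → ‹∀ F flat, ∫ … = Ew s›` (★ JUNCTION `kFiniteSection_whittaker_holomorphy_growth`'s literal shape) — and the
conclusion carries ONE abscissa `s₁` (`:= Σ_w max(s₀(w), 0)`, `σ` finite). [cite: Shimura1997, §16.4] [cite: KudlaRallis1994, §1–§2] -/
theorem exists_continuation_twisted_unipDeltaArch_of_record' (hT1 : ∀ w, T w * Tinv w = 1)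
    (hTiv : ∀ w (u : GL (Fin (2 + 2)) ℂ), u ∈ UnitaryGroup.archLocal L (2 + 2) (hermD L e dV hdV dW hdW) w →
      K2LiuSiegelUnipotentLocalDefs.IsUnipM (n := 2) (u : Matrix (Fin (2 + 2)) (Fin (2 + 2)) ℂ) →
        ∃ b : Matrix (Fin 2) (Fin 2) ℂ, bᴴ = b ∧ T w * Matrix.reindex (e₂ (n := 2)).symm (e₂ (n := 2)).symm (u : Matrix _ _ ℂ) * Tinv w = fromBlocks 1 b 0 1)
    (hTN : ∀ w (b : Matrix (Fin 2) (Fin 2) ℂ), bᴴ = b → ∃ u : GL (Fin (2 + 2)) ℂ,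
      u ∈ UnitaryGroup.archLocal L (2 + 2) (hermD L e dV hdV dW hdW) w ∧ K2LiuSiegelUnipotentLocalDefs.IsUnipM (n := 2) (u : Matrix (Fin (2 + 2)) (Fin (2 + 2)) ℂ) ∧
        T w * Matrix.reindex (e₂ (n := 2)).symm (e₂ (n := 2)).symm (u : Matrix _ _ ℂ) * Tinv w = fromBlocks 1 b 0 1)
    (νinf : Measure ↥(unipDeltaArch L e dV hdV dW hdW)) [νinf.IsHaarMeasure]
    (B C : {w : InfinitePlace L // w.IsComplex} → Matrix (Fin 2) (Fin 2) ℂ) (hBC : ∀ w, T w * fromBlocks 1 0 0 (-1) * Tinv w = fromBlocks 0 (B w) (C w) 0)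
    (k : {w : InfinitePlace L // w.IsComplex} → ℤ) (Q : {w : InfinitePlace L // w.IsComplex} → Carrier)
    (h : UnitaryGroup.arch (Fp L) L (IsCMField.complexConj L) (2 + 2) (hermD L e dV hdV dW hdW))
    (eb : {w : InfinitePlace L // w.IsComplex} → Matrix (Fin 2) (Fin 2) ℂ → ℂ)
    (Wt : ↥(unipDeltaArch L e dV hdV dW hdW) → ℂ)
    (hWt : ∀ u : ↥(unipDeltaArch L e dV hdV dW hdW),
      Wt u = ∏ w, eb w (Matrix.toBlocks₁₂ (Fr (u : UnitaryGroup.arch (Fp L) L (IsCMField.complexConj L) (2 + 2) (hermD L e dV hdV dW hdW)) w)))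
    (hW' : ∀ w, ∃ (Ew : ℂ → ℂ) (s₀ : ℝ), DifferentiableOn ℂ Ew {s : ℂ | 0 < s.re} ∧ ∀ s : ℂ, s₀ < s.re →
      ∀ F : Matrix (Fin 2 ⊕ Fin 2) (Fin 2 ⊕ Fin 2) ℂ → ℂ, IsArchSiegelSection (fun z : ℂ => (conj z / ((‖z‖ : ℝ) : ℂ)) ^ (k w)) s F →
        (∀ (v : Matrix (Fin 2) (Fin 2) ℂ), vᴴ * v = 1 → ∀ hv : v.det ≠ 0,
          F ((2 : ℂ)⁻¹ • fromBlocks (1 + v) (-(I • (1 - v))) (I • (1 - v)) (1 + v) : Matrix (Fin 2 ⊕ Fin 2) (Fin 2 ⊕ Fin 2) ℂ) = evalAt v hv (Q w)) →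
        ∫ r : Fin 2 → Fin 2 → ℝ, F ((fromBlocks 0 (B w) (C w) 0 : Matrix (Fin 2 ⊕ Fin 2) (Fin 2 ⊕ Fin 2) ℂ) * fromBlocks 1 (hermOfReal r) 0 1 * Fr h w) *
          eb w (hermOfReal r) = Ew s) :
    ∃ (E : ℂ → ℂ) (s₁ : ℝ), DifferentiableOn ℂ E {s : ℂ | 0 < s.re} ∧ ∀ s : ℂ, s₁ < s.re →
      ∀ F : {w : InfinitePlace L // w.IsComplex} → Matrix (Fin 2 ⊕ Fin 2) (Fin 2 ⊕ Fin 2) ℂ → ℂ,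
        (∀ w, IsArchSiegelSection (fun z : ℂ => (conj z / ((‖z‖ : ℝ) : ℂ)) ^ (k w)) s (F w)) →
        (∀ w, ∀ (v : Matrix (Fin 2) (Fin 2) ℂ), vᴴ * v = 1 → ∀ hv : v.det ≠ 0,
          (F w) ((2 : ℂ)⁻¹ • fromBlocks (1 + v) (-(I • (1 - v))) (I • (1 - v)) (1 + v) : Matrix (Fin 2 ⊕ Fin 2) (Fin 2 ⊕ Fin 2) ℂ) = evalAt v hv (Q w)) →
        ∫ u : ↥(unipDeltaArch L e dV hdV dW hdW), Wt u * ∏ w, F w (Fr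
            (UnitaryGroup.archPart (Fp L) L (IsCMField.complexConj L) (2 + 2) (hermD L e dV hdV dW hdW) (weylDelta L e dV hdV dW hdW) *
              (u : UnitaryGroup.arch (Fp L) L (IsCMField.complexConj L) (2 + 2) (hermD L e dV hdV dW hdW)) * h) w) ∂νinf = E s := by
  choose Ew s₀ hEw hEwq using hW'
  -- one abscissa above every place's
  have hle : ∀ w, s₀ w ≤ ∑ w', max (s₀ w') 0 := fun w =>
    (le_max_left _ _).trans (Finset.single_le_sum (f := fun w' => max (s₀ w') 0) (fun w' _ => le_max_right _ _) (Finset.mem_univ w))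
  obtain ⟨E, hE, hEq⟩ := exists_continuation_twisted_unipDeltaArch_of_record L e dV hdV dW hdW T Tinv Fr hFr hT2 hT1 hTiv hTN νinf B C hBC k Q h eb Wt hWt
    (∑ w', max (s₀ w') 0) (fun w => ⟨Ew w, hEw w, fun s hs F hF hQ => hEwq w s (lt_of_le_of_lt (hle w) hs) F hF hQ⟩)
  exact ⟨E, _, hE, hEq⟩

include hFr hT2 in
/-- **THE `hex` SHAPE, per-place abscissae**: as `exists_continuation_twisted_of_presentation` with `hW'` (abscissa inside each place's letter) and the presentation on
`{s₂ < re}`; the conclusion carries ONE abscissa `s₁ ≥ s₂`. [cite: Shimura1997, §16.4, §18.4] [cite: KudlaRallis1994, §1–§2] -/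
theorem exists_continuation_twisted_of_presentation' (hT1 : ∀ w, T w * Tinv w = 1)
    (hTiv : ∀ w (u : GL (Fin (2 + 2)) ℂ), u ∈ UnitaryGroup.archLocal L (2 + 2) (hermD L e dV hdV dW hdW) w →
      K2LiuSiegelUnipotentLocalDefs.IsUnipM (n := 2) (u : Matrix (Fin (2 + 2)) (Fin (2 + 2)) ℂ) →
        ∃ b : Matrix (Fin 2) (Fin 2) ℂ, bᴴ = b ∧ T w * Matrix.reindex (e₂ (n := 2)).symm (e₂ (n := 2)).symm (u : Matrix _ _ ℂ) * Tinv w = fromBlocks 1 b 0 1)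
    (hTN : ∀ w (b : Matrix (Fin 2) (Fin 2) ℂ), bᴴ = b → ∃ u : GL (Fin (2 + 2)) ℂ,
      u ∈ UnitaryGroup.archLocal L (2 + 2) (hermD L e dV hdV dW hdW) w ∧ K2LiuSiegelUnipotentLocalDefs.IsUnipM (n := 2) (u : Matrix (Fin (2 + 2)) (Fin (2 + 2)) ℂ) ∧
        T w * Matrix.reindex (e₂ (n := 2)).symm (e₂ (n := 2)).symm (u : Matrix _ _ ℂ) * Tinv w = fromBlocks 1 b 0 1)
    (νinf : Measure ↥(unipDeltaArch L e dV hdV dW hdW)) [νinf.IsHaarMeasure]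
    (B C : {w : InfinitePlace L // w.IsComplex} → Matrix (Fin 2) (Fin 2) ℂ) (hBC : ∀ w, T w * fromBlocks 1 0 0 (-1) * Tinv w = fromBlocks 0 (B w) (C w) 0)
    (k : {w : InfinitePlace L // w.IsComplex} → ℤ) (Q : {w : InfinitePlace L // w.IsComplex} → Carrier)
    (h : UnitaryGroup.arch (Fp L) L (IsCMField.complexConj L) (2 + 2) (hermD L e dV hdV dW hdW))
    (eb : {w : InfinitePlace L // w.IsComplex} → Matrix (Fin 2) (Fin 2) ℂ → ℂ)
    (Wt : ↥(unipDeltaArch L e dV hdV dW hdW) → ℂ)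
    (hWt : ∀ u : ↥(unipDeltaArch L e dV hdV dW hdW),
      Wt u = ∏ w, eb w (Matrix.toBlocks₁₂ (Fr (u : UnitaryGroup.arch (Fp L) L (IsCMField.complexConj L) (2 + 2) (hermD L e dV hdV dW hdW)) w)))
    (hW' : ∀ w, ∃ (Ew : ℂ → ℂ) (s₀ : ℝ), DifferentiableOn ℂ Ew {s : ℂ | 0 < s.re} ∧ ∀ s : ℂ, s₀ < s.re →
      ∀ F : Matrix (Fin 2 ⊕ Fin 2) (Fin 2 ⊕ Fin 2) ℂ → ℂ, IsArchSiegelSection (fun z : ℂ => (conj z / ((‖z‖ : ℝ) : ℂ)) ^ (k w)) s F →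
        (∀ (v : Matrix (Fin 2) (Fin 2) ℂ), vᴴ * v = 1 → ∀ hv : v.det ≠ 0,
          F ((2 : ℂ)⁻¹ • fromBlocks (1 + v) (-(I • (1 - v))) (I • (1 - v)) (1 + v) : Matrix (Fin 2 ⊕ Fin 2) (Fin 2 ⊕ Fin 2) ℂ) = evalAt v hv (Q w)) →
        ∫ r : Fin 2 → Fin 2 → ℝ, F ((fromBlocks 0 (B w) (C w) 0 : Matrix (Fin 2 ⊕ Fin 2) (Fin 2 ⊕ Fin 2) ℂ) * fromBlocks 1 (hermOfReal r) 0 1 * Fr h w) *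
          eb w (hermOfReal r) = Ew s)
    (Φfam : ℂ → UnitaryGroup.arch (Fp L) L (IsCMField.complexConj L) (2 + 2) (hermD L e dV hdV dW hdW) → ℂ)
    (Fs : ℂ → {w : InfinitePlace L // w.IsComplex} → Matrix (Fin 2 ⊕ Fin 2) (Fin 2 ⊕ Fin 2) ℂ → ℂ) (s₂ : ℝ)
    (hFs : ∀ s : ℂ, s₂ < s.re → ∀ w, IsArchSiegelSection (fun z : ℂ => (conj z / ((‖z‖ : ℝ) : ℂ)) ^ (k w)) s (Fs s w))
    (hFsQ : ∀ s : ℂ, s₂ < s.re → ∀ w, ∀ (v : Matrix (Fin 2) (Fin 2) ℂ), vᴴ * v = 1 → ∀ hv : v.det ≠ 0,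
      (Fs s w) ((2 : ℂ)⁻¹ • fromBlocks (1 + v) (-(I • (1 - v))) (I • (1 - v)) (1 + v) : Matrix (Fin 2 ⊕ Fin 2) (Fin 2 ⊕ Fin 2) ℂ) = evalAt v hv (Q w))
    (hpres : ∀ s : ℂ, s₂ < s.re → ∀ a : UnitaryGroup.arch (Fp L) L (IsCMField.complexConj L) (2 + 2) (hermD L e dV hdV dW hdW), Φfam s a = ∏ w, Fs s w (Fr a w)) :
    ∃ (E : ℂ → ℂ) (s₁ : ℝ), s₂ ≤ s₁ ∧ DifferentiableOn ℂ E {s : ℂ | 0 < s.re} ∧ ∀ s : ℂ, s₁ < s.re →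
      ∫ u : ↥(unipDeltaArch L e dV hdV dW hdW), Wt u * Φfam s
          (UnitaryGroup.archPart (Fp L) L (IsCMField.complexConj L) (2 + 2) (hermD L e dV hdV dW hdW) (weylDelta L e dV hdV dW hdW) *
            (u : UnitaryGroup.arch (Fp L) L (IsCMField.complexConj L) (2 + 2) (hermD L e dV hdV dW hdW)) * h) ∂νinf = E s := by
  obtain ⟨E, s₁, hE, hEq⟩ := exists_continuation_twisted_unipDeltaArch_of_record' L e dV hdV dW hdW T Tinv Fr hFr hT2 hT1 hTiv hTN νinf B C hBC k Q h eb Wt hWt hW'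
  refine ⟨E, max s₂ s₁, le_max_left _ _, hE, fun s hs => ?_⟩
  have hs₂ : s₂ < s.re := lt_of_le_of_lt (le_max_left _ _) hs
  have hs₁ : s₁ < s.re := lt_of_le_of_lt (le_max_right _ _) hs
  rw [← hEq s hs₁ (Fs s) (hFs s hs₂) (hFsQ s hs₂)]
  exact integral_congr_ae (Filter.Eventually.of_forall fun u => by simp only [hpres s hs₂])

/-! ## §5 Integrability of the twisted integrand on `{½ < re s}` (★ END (7a) × a unimodular weight) -/

include hFr hT2 hTU in
/-- **INTEGRABILITY OF THE TWISTED ARCH INTEGRAND** on `{½ < re s}`: ★ `K2LiuArchBlockOfFrameEnd.integrable_prod_unipDeltaArch_of_record` (the unweighted flat product is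
`ν_∞`-integrable) times a weight `Wt` that is a.e.-strongly measurable with `‖Wt u‖ ≤ 1` (Mathlib `Integrable.bdd_mul`). [cite: Shimura1997, §16.4] [cite: KudlaRallis1994, §1] -/
theorem integrable_twisted_prod_unipDeltaArch_of_record (hT1 : ∀ w, T w * Tinv w = 1)
    (hTiv : ∀ w (u : GL (Fin (2 + 2)) ℂ), u ∈ UnitaryGroup.archLocal L (2 + 2) (hermD L e dV hdV dW hdW) w →
      K2LiuSiegelUnipotentLocalDefs.IsUnipM (n := 2) (u : Matrix (Fin (2 + 2)) (Fin (2 + 2)) ℂ) →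
        ∃ b : Matrix (Fin 2) (Fin 2) ℂ, bᴴ = b ∧ T w * Matrix.reindex (e₂ (n := 2)).symm (e₂ (n := 2)).symm (u : Matrix _ _ ℂ) * Tinv w = fromBlocks 1 b 0 1)
    (hTN : ∀ w (b : Matrix (Fin 2) (Fin 2) ℂ), bᴴ = b → ∃ u : GL (Fin (2 + 2)) ℂ,
      u ∈ UnitaryGroup.archLocal L (2 + 2) (hermD L e dV hdV dW hdW) w ∧ K2LiuSiegelUnipotentLocalDefs.IsUnipM (n := 2) (u : Matrix (Fin (2 + 2)) (Fin (2 + 2)) ℂ) ∧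
        T w * Matrix.reindex (e₂ (n := 2)).symm (e₂ (n := 2)).symm (u : Matrix _ _ ℂ) * Tinv w = fromBlocks 1 b 0 1)
    (νinf : Measure ↥(unipDeltaArch L e dV hdV dW hdW)) [νinf.IsHaarMeasure]
    (B C : {w : InfinitePlace L // w.IsComplex} → Matrix (Fin 2) (Fin 2) ℂ) (hBC : ∀ w, T w * fromBlocks 1 0 0 (-1) * Tinv w = fromBlocks 0 (B w) (C w) 0)
    (k : {w : InfinitePlace L // w.IsComplex} → ℤ) (Q : {w : InfinitePlace L // w.IsComplex} → Carrier)
    (h : UnitaryGroup.arch (Fp L) L (IsCMField.complexConj L) (2 + 2) (hermD L e dV hdV dW hdW))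
    (Wt : ↥(unipDeltaArch L e dV hdV dW hdW) → ℂ) (hWtm : AEStronglyMeasurable Wt νinf) (hWt1 : ∀ u, ‖Wt u‖ ≤ 1)
    {s : ℂ} (hs : 1 / 2 < s.re) (F : {w : InfinitePlace L // w.IsComplex} → Matrix (Fin 2 ⊕ Fin 2) (Fin 2 ⊕ Fin 2) ℂ → ℂ)
    (hF : ∀ w, IsArchSiegelSection (fun z : ℂ => (conj z / ((‖z‖ : ℝ) : ℂ)) ^ (k w)) s (F w))
    (hQ : ∀ w, ∀ (v : Matrix (Fin 2) (Fin 2) ℂ), vᴴ * v = 1 → ∀ hv : v.det ≠ 0,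
      (F w) ((2 : ℂ)⁻¹ • fromBlocks (1 + v) (-(I • (1 - v))) (I • (1 - v)) (1 + v) : Matrix (Fin 2 ⊕ Fin 2) (Fin 2 ⊕ Fin 2) ℂ) = evalAt v hv (Q w)) :
    Integrable (fun u : ↥(unipDeltaArch L e dV hdV dW hdW) => Wt u * ∏ w, F w (Fr
        (UnitaryGroup.archPart (Fp L) L (IsCMField.complexConj L) (2 + 2) (hermD L e dV hdV dW hdW) (weylDelta L e dV hdV dW hdW) *
          (u : UnitaryGroup.arch (Fp L) L (IsCMField.complexConj L) (2 + 2) (hermD L e dV hdV dW hdW)) * h) w)) νinf :=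
  (integrable_prod_unipDeltaArch_of_record L e dV hdV dW hdW T Tinv Fr hFr hT2 hTU hT1 hTiv hTN νinf B C hBC k Q h hs F hF hQ).bdd_mul hWtm
    (Filter.Eventually.of_forall hWt1)

end Summit.HodgeConjecture.HodgeConjecture.Cruxes.HLiu418.K2LiuKindWArchContinuation

end
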